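import Mathlib
import Literature.Geometry.Symplectic.SteinBall
import Summits.SmoothPoincare4.SmoothPoincare4.Theorems.HyperbolicEnd.Negative.PsiContDiff
import Summits.SmoothPoincare4.SmoothPoincare4.Theorems.HyperbolicEnd.Negative.PsiSlice

/-!
# `HyperbolicEnd` (stmt-SmoothPoincare4-7825), line `Sketch`, negative side — `J₀`-plurisubharmonicity of `ψ_M`

Helper for the native frozen refutation of `stub_certificateFill` on `ℝ⁴ = EuclideanSpace ℝ (Fin 4)`
(stub helper_frozen_hessianBound, registered on the crux item).

With `q₁ x = x 0 ^ 2 + x 1 ^ 2`, `q₂ x = x 2 ^ 2 + x 3 ^ 2`, `ε = 1/1000`, the cutoff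
`χ t = Real.smoothTransition ((81/100 - t) * (25/14))` (`= 0` for `t ≥ 81/100`) and
`ψ_M x = -8 χ (q₂ x) log (q₁ x + ε) + M q₂ x + (q₁ x + q₂ x)`, we show that for a suitable
`M ≥ 0` the `J₀`-trace of the Hessian dominates `2‖v‖²` on the shell `1 < ‖x‖ < 4`,
`H := D²ψ_M(x)[v, v] + D²ψ_M(x)[J₀v, J₀v] ≥ 2‖v‖²` (`J₀ = stdComplexStructure`), and that
`ψ_M ≤ 30 + 16 M` there.

**Proof.** By the slice formula (`helper_frozen_psiSlice`, for `v` and for `J₀ v`, whose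
coordinates are `(-v 1, v 0, -v 3, v 2)`) and the Lagrange identities `β₁² + β₁'² = q₁ γ₁`,
`β₂² + β₂'² = q₂ γ₂` (`βⱼ`, `γⱼ` the line data of `v`, `βⱼ'` those of `J₀ v`),
`H = -32 (χ'' q₂ + χ') γ₂ L - 64 χ' P / a - 32 χ ε γ₁ / a² + 4 M γ₂ + 4 γ₁ + 4 γ₂` with
`a = q₁ + ε`, `L = log a`, `P = β₁ β₂ + β₁' β₂'`, `P² ≤ q₁ γ₁ q₂ γ₂` (`hessian_identity`).  On the
shell `q₂ ∈ [0, 16]`, so `|χ'|, |χ''| ≤ C` (a compactness constant, `chi_derivs_bound`),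
`|L| ≤ 1000` (`1 - 1/a ≤ log a ≤ a - 1`), whence the three correction terms are bounded below by
`-544000 C γ₂`, `-γ₁ - 4096000 C² γ₂` (squares: `|DP| ≤ γ₁ + D² q₁ q₂ γ₂ / 4` and
`q₁ ≤ 250 a²`) and `-γ₁` (either `q₂ ≥ 81/100` and `χ = 0`, or `q₁ > 19/100` and `32 ε ≤ a²`);
`M := 136000 C + 1024000 C²` absorbs the `γ₂`-terms.  For the level bound, `-8 χ L ≤ 14` since
`L > -7/4` wherever `χ ≠ 0` (`a > 191/1000 > e^{-7/4}`, from `e > 2.718` and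
`e^{3/4} ≥ 1 + 3/4 + 9/32`), `M q₂ ≤ 16 M` and `q₁ + q₂ < 16`.
-/

noncomputable section

-- the prescribed namespace `Summit.<P>.<Sub>.…` duplicates `SmoothPoincare4` (P = Sub)
set_option linter.dupNamespace false

open scoped ContDiff Topology Real
open Laplacian Set Filter Metric Complex

namespace Summit.SmoothPoincare4.SmoothPoincare4.Theorems.HyperbolicEnd.Negative

open Literature.Geometry.Symplectic

/-! ### The cutoff profile -/

/-- `χ` is smooth. -/
private theorem chi_smooth :
    ContDiff ℝ ∞ (fun t : ℝ => Real.smoothTransition ((81 / 100 - t) * (25 / 14))) :=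
  Real.smoothTransition.contDiff.comp ((contDiff_const.sub contDiff_id).mul contDiff_const)

/-- A common bound `C ≥ 0` for `|χ'|` and `|χ''|` on `[0, 16]` (continuity on a compact interval). -/
private theorem chi_derivs_bound : ∃ C : ℝ, 0 ≤ C ∧ ∀ t ∈ Icc (0 : ℝ) 16,
    |deriv (fun t : ℝ => Real.smoothTransition ((81 / 100 - t) * (25 / 14))) t| ≤ C ∧
    |deriv (deriv (fun t : ℝ => Real.smoothTransition ((81 / 100 - t) * (25 / 14)))) t| ≤ C := by
  have h1 := (contDiff_infty_iff_deriv.mp chi_smooth).2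
  have h2 := (contDiff_infty_iff_deriv.mp h1).2
  obtain ⟨K₁, hK₁⟩ := (isCompact_Icc : IsCompact (Icc (0 : ℝ) 16)).exists_bound_of_continuousOn
    h1.continuous.continuousOn
  obtain ⟨K₂, hK₂⟩ := (isCompact_Icc : IsCompact (Icc (0 : ℝ) 16)).exists_bound_of_continuousOn
    h2.continuous.continuousOn
  refine ⟨max 0 (max K₁ K₂), le_max_left _ _, fun t ht => ⟨?_, ?_⟩⟩
  · have := hK₁ t ht
    rw [Real.norm_eq_abs] at this
    exact this.trans ((le_max_left _ _).trans (le_max_right _ _))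
  · have := hK₂ t ht
    rw [Real.norm_eq_abs] at this
    exact this.trans ((le_max_right _ _).trans (le_max_right _ _))

/-- `χ t = 0` for `t ≥ 81/100`. -/
private theorem chi_zero_of_le {t : ℝ} (h : 81 / 100 ≤ t) :
    Real.smoothTransition ((81 / 100 - t) * (25 / 14)) = 0 :=
  Real.smoothTransition.zero_of_nonpos (by linarith)

/-! ### Numerical facts -/

/-- `|log (q + ε)| ≤ 1000` for `0 ≤ q < 16` (from `1 - 1/a ≤ log a ≤ a - 1`). -/
private theorem abs_log_le {q : ℝ} (hq : 0 ≤ q) (hq' : q < 16) :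
    |Real.log (q + 1 / 1000)| ≤ 1000 := by
  have ha : 0 < q + 1 / 1000 := by linarith
  rw [abs_le]
  constructor
  · have h1 := Real.one_sub_inv_le_log_of_pos ha
    have h2 : (q + 1 / 1000)⁻¹ ≤ 1000 := by
      rw [inv_le_comm₀ ha (by norm_num)]
      linarith
    linarith
  · have := Real.log_le_sub_one_of_pos ha
    linarith

/-- `log a > -7/4` for `a > 191/1000` (as `e^{7/4} = e · e^{3/4} > 2.718 · (1 + 3/4 + 9/32) > 1000/191`). -/
private theorem neg_lt_log {a : ℝ} (ha : 191 / 1000 < a) : -(7 / 4) < Real.log a := by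
  have ha0 : 0 < a := by linarith
  rw [Real.lt_log_iff_exp_lt ha0]
  have h1 : (2.7182818283 : ℝ) < Real.exp 1 := Real.exp_one_gt_d9
  have h2 : 1 + 3 / 4 + (3 / 4) ^ 2 / 2 ≤ Real.exp (3 / 4 : ℝ) :=
    Real.quadratic_le_exp_of_nonneg (by norm_num)
  have h3 : (1000 / 191 : ℝ) < Real.exp (7 / 4) := by
    have : Real.exp (7 / 4 : ℝ) = Real.exp 1 * Real.exp (3 / 4) := by
      rw [← Real.exp_add]; norm_num
    rw [this]
    nlinarith [Real.exp_pos (3 / 4 : ℝ), Real.exp_pos (1 : ℝ)]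
  have h4 : Real.exp (-(7 / 4) : ℝ) * Real.exp (7 / 4) = 1 := by
    rw [← Real.exp_add]; norm_num
  nlinarith [Real.exp_pos (-(7 / 4) : ℝ), Real.exp_pos (7 / 4 : ℝ)]

/-! ### The three correction terms -/

/-- The `log`-term: `-32 (χ'' q₂ + χ') γ₂ L ≥ -544000 C γ₂`. -/
private theorem logTerm_bound {c₁ c₂ L C q₂ γ₂ : ℝ} (hc₁ : |c₁| ≤ C) (hc₂ : |c₂| ≤ C)
    (hL : |L| ≤ 1000) (hq₂ : 0 ≤ q₂) (hq₂' : q₂ ≤ 16) (hγ₂ : 0 ≤ γ₂) :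
    -(544000 * C * γ₂) ≤ -32 * (c₂ * q₂ + c₁) * γ₂ * L := by
  have hC : 0 ≤ C := (abs_nonneg _).trans hc₁
  have h1 : |c₂ * q₂ + c₁| ≤ 17 * C := by
    calc |c₂ * q₂ + c₁| ≤ |c₂ * q₂| + |c₁| := abs_add_le _ _
      _ = |c₂| * q₂ + |c₁| := by rw [abs_mul, abs_of_nonneg hq₂]
      _ ≤ 17 * C := by nlinarith [abs_nonneg c₂]
  have h2 : |(c₂ * q₂ + c₁) * L| ≤ 17 * C * 1000 := by
    rw [abs_mul]
    exact mul_le_mul h1 hL (abs_nonneg _) (by positivity)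
  have h3 : (c₂ * q₂ + c₁) * L ≤ 17000 * C := by
    have := le_abs_self ((c₂ * q₂ + c₁) * L)
    linarith
  nlinarith [mul_le_mul_of_nonneg_left h3 (by positivity : (0 : ℝ) ≤ 32 * γ₂)]

/-- The cross term: `-64 χ' P / a ≥ -γ₁ - 4096000 C² γ₂` when `P² ≤ q₁ γ₁ q₂ γ₂` and
`q₁ ≤ 250 a²`. -/
private theorem crossTerm_bound {c₁ C q₁ q₂ γ₁ γ₂ P a : ℝ} (hc₁ : |c₁| ≤ C)
    (hP : P ^ 2 ≤ q₁ * γ₁ * (q₂ * γ₂)) (ha : 0 < a) (hq₁a : q₁ ≤ 250 * a ^ 2) (hq₁ : 0 ≤ q₁)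
    (hq₂ : 0 ≤ q₂) (hq₂' : q₂ ≤ 16) (hγ₁ : 0 ≤ γ₁) (hγ₂ : 0 ≤ γ₂) :
    -γ₁ - 4096000 * C ^ 2 * γ₂ ≤ -64 * c₁ * P / a := by
  have hc₁sq : c₁ ^ 2 ≤ C ^ 2 := by
    have h := abs_le.mp hc₁
    nlinarith [sq_abs c₁, abs_nonneg c₁]
  -- `W = D² q₁ q₂ γ₂ / 4` with `D = 64 χ'/a`
  have hW0 : 0 ≤ 1024 * c₁ ^ 2 * q₁ * q₂ * γ₂ / a ^ 2 :=
    div_nonneg (mul_nonneg (mul_nonneg (mul_nonneg (by positivity) hq₁) hq₂) hγ₂) (sq_nonneg a)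
  have hW : 1024 * c₁ ^ 2 * q₁ * q₂ * γ₂ / a ^ 2 ≤ 4096000 * C ^ 2 * γ₂ := by
    rw [div_le_iff₀ (by positivity)]
    have h1 : c₁ ^ 2 * q₁ ≤ C ^ 2 * (250 * a ^ 2) := mul_le_mul hc₁sq hq₁a hq₁ (sq_nonneg C)
    have h2 : c₁ ^ 2 * q₁ * q₂ ≤ C ^ 2 * (250 * a ^ 2) * 16 :=
      mul_le_mul h1 hq₂' hq₂ (by positivity)
    nlinarith [mul_le_mul_of_nonneg_right h2 hγ₂]
  have habs : |64 * c₁ * P / a| ≤ γ₁ + 1024 * c₁ ^ 2 * q₁ * q₂ * γ₂ / a ^ 2 := by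
    refine abs_le_of_sq_le_sq ?_ (by linarith)
    have e1 : (64 * c₁ * P / a) ^ 2 = 4096 * c₁ ^ 2 * P ^ 2 / a ^ 2 := by ring
    have e2 : 4 * γ₁ * (1024 * c₁ ^ 2 * q₁ * q₂ * γ₂ / a ^ 2) =
        4096 * c₁ ^ 2 * (q₁ * γ₁ * (q₂ * γ₂)) / a ^ 2 := by ring
    have h3 : 4096 * c₁ ^ 2 * P ^ 2 / a ^ 2 ≤ 4096 * c₁ ^ 2 * (q₁ * γ₁ * (q₂ * γ₂)) / a ^ 2 :=
      div_le_div_of_nonneg_right (mul_le_mul_of_nonneg_left hP (by positivity)) (sq_nonneg a)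
    nlinarith [sq_nonneg (γ₁ - 1024 * c₁ ^ 2 * q₁ * q₂ * γ₂ / a ^ 2)]
  have e3 : -64 * c₁ * P / a = -(64 * c₁ * P / a) := by ring
  rw [e3]
  linarith [le_abs_self (64 * c₁ * P / a)]

/-- The `ε`-term: `-32 χ ε γ₁ / a² ≥ -γ₁` when `q₁ > 19/100` or `χ = 0`. -/
private theorem epsTerm_bound {c₀ q₁ γ₁ : ℝ} (hc₀ : 0 ≤ c₀) (hc₀' : c₀ ≤ 1) (hγ₁ : 0 ≤ γ₁)
    (h : 19 / 100 < q₁ ∨ c₀ = 0) :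
    -γ₁ ≤ -(4 * c₀ * γ₁) / (125 * (q₁ + 1 / 1000) ^ 2) := by
  rcases h with h | h
  · rw [neg_div, neg_le_neg_iff, div_le_iff₀ (by positivity)]
    have h2 : (4 : ℝ) ≤ 125 * (q₁ + 1 / 1000) ^ 2 := by nlinarith [sq_nonneg (q₁ - 19 / 100)]
    calc 4 * c₀ * γ₁ ≤ 4 * γ₁ := by nlinarith [mul_le_mul_of_nonneg_right hc₀' hγ₁]
      _ ≤ γ₁ * (125 * (q₁ + 1 / 1000) ^ 2) := by nlinarith [mul_le_mul_of_nonneg_left h2 hγ₁]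
  · subst h
    simp only [mul_zero, zero_mul, neg_zero, zero_div, Left.neg_nonpos_iff]
    exact hγ₁

/-! ### The `J₀`-trace of the slice Hessians: algebra and the main inequality -/

/-- **The pointwise inequality.** For reals with `|χ'|, |χ''| ≤ C`, `0 ≤ χ ≤ 1`, `|L| ≤ 1000`,
`q₁ + q₂ < 16`, (`q₁ > 19/100` or `χ = 0`) and `M = 136000 C + 1024000 C²`, the sum of the
slice Hessians (the registered closed forms) at `v` and at `J₀ v = (-v₁, v₀, -v₃, v₂)` is
at least `2 (v₀² + v₁² + v₂² + v₃²)`. -/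
private theorem hessian_ineq (x₀ x₁ x₂ x₃ v₀ v₁ v₂ v₃ w₀ w₁ w₂ w₃ c₀ c₁ c₂ L M C : ℝ)
    (hM : M = 136000 * C + 1024000 * C ^ 2) (hc₀ : 0 ≤ c₀) (hc₀' : c₀ ≤ 1)
    (hc₁ : |c₁| ≤ C) (hc₂ : |c₂| ≤ C) (hL : |L| ≤ 1000)
    (h16 : x₀ ^ 2 + x₁ ^ 2 + x₂ ^ 2 + x₃ ^ 2 < 16) (hT3 : 19 / 100 < x₀ ^ 2 + x₁ ^ 2 ∨ c₀ = 0)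
    (hw₀ : w₀ = -v₁) (hw₁ : w₁ = v₀) (hw₂ : w₂ = -v₃) (hw₃ : w₃ = v₂) :
    2 * (v₀ ^ 2 + v₁ ^ 2 + v₂ ^ 2 + v₃ ^ 2) ≤
      (-8 * (c₂ * (2 * (x₂ * v₂ + x₃ * v₃)) ^ 2 * L + c₁ * (2 * (v₂ ^ 2 + v₃ ^ 2)) * L +
            2 * (c₁ * (2 * (x₂ * v₂ + x₃ * v₃))) * (2 * (x₀ * v₀ + x₁ * v₁) / (x₀ ^ 2 + x₁ ^ 2 + 1 / 1000)) +
            c₀ * ((2 * (v₀ ^ 2 + v₁ ^ 2) * (x₀ ^ 2 + x₁ ^ 2 + 1 / 1000) - (2 * (x₀ * v₀ + x₁ * v₁)) ^ 2) /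
              (x₀ ^ 2 + x₁ ^ 2 + 1 / 1000) ^ 2)) +
          M * (2 * (v₂ ^ 2 + v₃ ^ 2)) + (2 * (v₀ ^ 2 + v₁ ^ 2) + 2 * (v₂ ^ 2 + v₃ ^ 2))) +
      (-8 * (c₂ * (2 * (x₂ * w₂ + x₃ * w₃)) ^ 2 * L + c₁ * (2 * (w₂ ^ 2 + w₃ ^ 2)) * L +
            2 * (c₁ * (2 * (x₂ * w₂ + x₃ * w₃))) * (2 * (x₀ * w₀ + x₁ * w₁) / (x₀ ^ 2 + x₁ ^ 2 + 1 / 1000)) +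
            c₀ * ((2 * (w₀ ^ 2 + w₁ ^ 2) * (x₀ ^ 2 + x₁ ^ 2 + 1 / 1000) - (2 * (x₀ * w₀ + x₁ * w₁)) ^ 2) /
              (x₀ ^ 2 + x₁ ^ 2 + 1 / 1000) ^ 2)) +
          M * (2 * (w₂ ^ 2 + w₃ ^ 2)) + (2 * (w₀ ^ 2 + w₁ ^ 2) + 2 * (w₂ ^ 2 + w₃ ^ 2))) := by
  subst hw₀ hw₂
  rw [hw₁, hw₃]
  have ha : 0 < x₀ ^ 2 + x₁ ^ 2 + 1 / 1000 := by positivity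
  -- the `J₀`-trace in closed form (Lagrange identities built in)
  have key :
      (-8 * (c₂ * (2 * (x₂ * v₂ + x₃ * v₃)) ^ 2 * L + c₁ * (2 * (v₂ ^ 2 + v₃ ^ 2)) * L +
            2 * (c₁ * (2 * (x₂ * v₂ + x₃ * v₃))) * (2 * (x₀ * v₀ + x₁ * v₁) / (x₀ ^ 2 + x₁ ^ 2 + 1 / 1000)) +
            c₀ * ((2 * (v₀ ^ 2 + v₁ ^ 2) * (x₀ ^ 2 + x₁ ^ 2 + 1 / 1000) - (2 * (x₀ * v₀ + x₁ * v₁)) ^ 2) /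
              (x₀ ^ 2 + x₁ ^ 2 + 1 / 1000) ^ 2)) +
          M * (2 * (v₂ ^ 2 + v₃ ^ 2)) + (2 * (v₀ ^ 2 + v₁ ^ 2) + 2 * (v₂ ^ 2 + v₃ ^ 2))) +
      (-8 * (c₂ * (2 * (x₂ * -v₃ + x₃ * v₂)) ^ 2 * L + c₁ * (2 * ((-v₃) ^ 2 + v₂ ^ 2)) * L +
            2 * (c₁ * (2 * (x₂ * -v₃ + x₃ * v₂))) * (2 * (x₀ * -v₁ + x₁ * v₀) / (x₀ ^ 2 + x₁ ^ 2 + 1 / 1000)) +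
            c₀ * ((2 * ((-v₁) ^ 2 + v₀ ^ 2) * (x₀ ^ 2 + x₁ ^ 2 + 1 / 1000) - (2 * (x₀ * -v₁ + x₁ * v₀)) ^ 2) /
              (x₀ ^ 2 + x₁ ^ 2 + 1 / 1000) ^ 2)) +
          M * (2 * ((-v₃) ^ 2 + v₂ ^ 2)) + (2 * ((-v₁) ^ 2 + v₀ ^ 2) + 2 * ((-v₃) ^ 2 + v₂ ^ 2))) =
      -32 * (c₂ * (x₂ ^ 2 + x₃ ^ 2) + c₁) * (v₂ ^ 2 + v₃ ^ 2) * L +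
        -64 * c₁ * ((x₀ * v₀ + x₁ * v₁) * (x₂ * v₂ + x₃ * v₃) + (x₁ * v₀ - x₀ * v₁) * (x₃ * v₂ - x₂ * v₃)) /
          (x₀ ^ 2 + x₁ ^ 2 + 1 / 1000) +
        -(4 * c₀ * (v₀ ^ 2 + v₁ ^ 2)) / (125 * (x₀ ^ 2 + x₁ ^ 2 + 1 / 1000) ^ 2) +
        4 * M * (v₂ ^ 2 + v₃ ^ 2) + 4 * (v₀ ^ 2 + v₁ ^ 2) + 4 * (v₂ ^ 2 + v₃ ^ 2) := by
    field_simp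
    ring
  rw [key]
  have hq₂ : (0 : ℝ) ≤ x₂ ^ 2 + x₃ ^ 2 := by positivity
  have hq₂' : x₂ ^ 2 + x₃ ^ 2 ≤ 16 := by linarith [sq_nonneg x₀, sq_nonneg x₁]
  have hγ₁ : (0 : ℝ) ≤ v₀ ^ 2 + v₁ ^ 2 := by positivity
  have hγ₂ : (0 : ℝ) ≤ v₂ ^ 2 + v₃ ^ 2 := by positivity
  have hT1 := logTerm_bound hc₁ hc₂ hL hq₂ hq₂' hγ₂
  have hP : ((x₀ * v₀ + x₁ * v₁) * (x₂ * v₂ + x₃ * v₃) + (x₁ * v₀ - x₀ * v₁) * (x₃ * v₂ - x₂ * v₃)) ^ 2 ≤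
      (x₀ ^ 2 + x₁ ^ 2) * (v₀ ^ 2 + v₁ ^ 2) * ((x₂ ^ 2 + x₃ ^ 2) * (v₂ ^ 2 + v₃ ^ 2)) := by
    rw [← sub_nonneg]
    have e : (x₀ ^ 2 + x₁ ^ 2) * (v₀ ^ 2 + v₁ ^ 2) * ((x₂ ^ 2 + x₃ ^ 2) * (v₂ ^ 2 + v₃ ^ 2)) -
        ((x₀ * v₀ + x₁ * v₁) * (x₂ * v₂ + x₃ * v₃) + (x₁ * v₀ - x₀ * v₁) * (x₃ * v₂ - x₂ * v₃)) ^ 2 =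
        ((x₀ * v₀ + x₁ * v₁) * (x₃ * v₂ - x₂ * v₃) - (x₁ * v₀ - x₀ * v₁) * (x₂ * v₂ + x₃ * v₃)) ^ 2 := by
      ring
    rw [e]
    exact sq_nonneg _
  have hq₁a : x₀ ^ 2 + x₁ ^ 2 ≤ 250 * (x₀ ^ 2 + x₁ ^ 2 + 1 / 1000) ^ 2 := by
    rw [← sub_nonneg]
    have e : 250 * (x₀ ^ 2 + x₁ ^ 2 + 1 / 1000) ^ 2 - (x₀ ^ 2 + x₁ ^ 2) =
        250 * (x₀ ^ 2 + x₁ ^ 2 - 1 / 1000) ^ 2 := by ring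
    rw [e]
    positivity
  have hT2 := crossTerm_bound (γ₁ := v₀ ^ 2 + v₁ ^ 2) hc₁ hP ha hq₁a (by positivity) hq₂ hq₂' hγ₁ hγ₂
  have hT3 := epsTerm_bound hc₀ hc₀' hγ₁ hT3
  subst hM
  linarith

/-- **The level bound.** On the shell, `ψ_M ≤ 30 + 16 M` (for `M ≥ 0`). -/
private theorem level_ineq (x₀ x₁ x₂ x₃ M : ℝ) (hM : 0 ≤ M)
    (h16 : x₀ ^ 2 + x₁ ^ 2 + x₂ ^ 2 + x₃ ^ 2 < 16) (h1 : 1 < x₀ ^ 2 + x₁ ^ 2 + x₂ ^ 2 + x₃ ^ 2) :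
    -8 * Real.smoothTransition ((81 / 100 - (x₂ ^ 2 + x₃ ^ 2)) * (25 / 14)) *
          Real.log (x₀ ^ 2 + x₁ ^ 2 + 1 / 1000) + M * (x₂ ^ 2 + x₃ ^ 2) +
        (x₀ ^ 2 + x₁ ^ 2 + x₂ ^ 2 + x₃ ^ 2) ≤ 30 + 16 * M := by
  have hq₂M : M * (x₂ ^ 2 + x₃ ^ 2) ≤ 16 * M := by
    have hq₂' : x₂ ^ 2 + x₃ ^ 2 ≤ 16 := by linarith [sq_nonneg x₀, sq_nonneg x₁]
    have := mul_le_mul_of_nonneg_left hq₂' hM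
    linarith
  have hχL : -8 * Real.smoothTransition ((81 / 100 - (x₂ ^ 2 + x₃ ^ 2)) * (25 / 14)) *
      Real.log (x₀ ^ 2 + x₁ ^ 2 + 1 / 1000) ≤ 14 := by
    rcases le_or_gt (81 / 100) (x₂ ^ 2 + x₃ ^ 2) with h | h
    · rw [chi_zero_of_le h]; norm_num
    · have hL := neg_lt_log (a := x₀ ^ 2 + x₁ ^ 2 + 1 / 1000) (by linarith)
      have hc₀ := Real.smoothTransition.nonneg ((81 / 100 - (x₂ ^ 2 + x₃ ^ 2)) * (25 / 14))
      have hc₀' := Real.smoothTransition.le_one ((81 / 100 - (x₂ ^ 2 + x₃ ^ 2)) * (25 / 14))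
      nlinarith [mul_nonneg hc₀ (by linarith : (0 : ℝ) ≤ Real.log (x₀ ^ 2 + x₁ ^ 2 + 1 / 1000) + 7 / 4)]
  linarith

/-- Coordinates of a point of the shell `ball 0 4 \ closedBall 0 1`: `1 < Σ xᵢ² < 16`. -/
private theorem shell_coords {x : EuclideanSpace ℝ (Fin 4)}
    (hx : x ∈ Metric.ball (0 : EuclideanSpace ℝ (Fin 4)) 4 \ Metric.closedBall (0 : EuclideanSpace ℝ (Fin 4)) 1) :
    1 < x 0 ^ 2 + x 1 ^ 2 + x 2 ^ 2 + x 3 ^ 2 ∧ x 0 ^ 2 + x 1 ^ 2 + x 2 ^ 2 + x 3 ^ 2 < 16 := by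
  have hx4 : ‖x‖ < 4 := by simpa using hx.1
  have hx1 : 1 < ‖x‖ := by simpa using hx.2
  have hn : ‖x‖ ^ 2 = x 0 ^ 2 + x 1 ^ 2 + x 2 ^ 2 + x 3 ^ 2 := by
    rw [EuclideanSpace.real_norm_sq_eq, Fin.sum_univ_four]
  constructor <;> nlinarith [norm_nonneg x]

/-! ### The helper -/

/-- helper (T5c): for a suitable `M ≥ 0`, the `J₀`-trace of the Hessian of
`ψ_M x = -8 χ(q₂ x) log(q₁ x + 10⁻³) + M q₂ x + (q₁ x + q₂ x)` dominates `2‖v‖²` on the shell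
`1 < ‖x‖ < 4`, and `ψ_M ≤ 30 + 16 M` there. -/
theorem helper_frozen_hessianBound : ∃ M : ℝ, 0 ≤ M ∧ (∀ x ∈ Metric.ball (0 : EuclideanSpace ℝ (Fin 4)) 4 \ Metric.closedBall (0 : EuclideanSpace ℝ (Fin 4)) 1, ∀ v : EuclideanSpace ℝ (Fin 4), 2 * ‖v‖ ^ 2 ≤ iteratedFDeriv ℝ 2 (fun y : EuclideanSpace ℝ (Fin 4) => -8 * Real.smoothTransition ((81 / 100 - (y 2 ^ 2 + y 3 ^ 2)) * (25 / 14)) * Real.log (y 0 ^ 2 + y 1 ^ 2 + 1 / 1000) + M * (y 2 ^ 2 + y 3 ^ 2) + (y 0 ^ 2 + y 1 ^ 2 + y 2 ^ 2 + y 3 ^ 2)) x ![v, v] + iteratedFDeriv ℝ 2 (fun y : EuclideanSpace ℝ (Fin 4) => -8 * Real.smoothTransition ((81 / 100 - (y 2 ^ 2 + y 3 ^ 2)) * (25 / 14)) * Real.log (y 0 ^ 2 + y 1 ^ 2 + 1 / 1000) + M * (y 2 ^ 2 + y 3 ^ 2) + (y 0 ^ 2 + y 1 ^ 2 + y 2 ^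 2 + y 3 ^ 2)) x ![Literature.Geometry.Symplectic.stdComplexStructure v, Literature.Geometry.Symplectic.stdComplexStructure v]) ∧ (∀ x ∈ Metric.ball (0 : EuclideanSpace ℝ (Fin 4)) 4 \ Metric.closedBall (0 : EuclideanSpace ℝ (Fin 4)) 1, -8 * Real.smoothTransition ((81 / 100 - (x 2 ^ 2 + x 3 ^ 2)) * (25 / 14)) * Real.log (x 0 ^ 2 + x 1 ^ 2 + 1 / 1000) + M * (x 2 ^ 2 + x 3 ^ 2) + (x 0 ^ 2 + x 1 ^ 2 + x 2 ^ 2 + x 3 ^ 2) ≤ 30 + 16 * M) := by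
  obtain ⟨C, hC0, hC⟩ := chi_derivs_bound
  refine ⟨136000 * C + 1024000 * C ^ 2, by positivity, fun x hx v => ?_, fun x hx => ?_⟩
  · obtain ⟨h1, h16⟩ := shell_coords hx
    have hq₂mem : x 2 ^ 2 + x 3 ^ 2 ∈ Icc (0 : ℝ) 16 :=
      ⟨by positivity, by linarith [sq_nonneg (x 0), sq_nonneg (x 1)]⟩
    obtain ⟨hc₁, hc₂⟩ := hC _ hq₂mem
    have hL : |Real.log (x 0 ^ 2 + x 1 ^ 2 + 1 / 1000)| ≤ 1000 :=
      abs_log_le (by positivity) (by linarith [sq_nonneg (x 2), sq_nonneg (x 3)])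
    have hc₀ := Real.smoothTransition.nonneg ((81 / 100 - (x 2 ^ 2 + x 3 ^ 2)) * (25 / 14))
    have hc₀' := Real.smoothTransition.le_one ((81 / 100 - (x 2 ^ 2 + x 3 ^ 2)) * (25 / 14))
    have hT3 : 19 / 100 < x 0 ^ 2 + x 1 ^ 2 ∨
        Real.smoothTransition ((81 / 100 - (x 2 ^ 2 + x 3 ^ 2)) * (25 / 14)) = 0 := by
      rcases lt_or_ge (x 2 ^ 2 + x 3 ^ 2) (81 / 100) with h | h
      · left; linarith
      · right; exact chi_zero_of_le h
    rw [helper_frozen_psiSlice, helper_frozen_psiSlice, EuclideanSpace.real_norm_sq_eq,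
      Fin.sum_univ_four]
    exact hessian_ineq (x 0) (x 1) (x 2) (x 3) (v 0) (v 1) (v 2) (v 3)
      (stdComplexStructure v 0) (stdComplexStructure v 1) (stdComplexStructure v 2)
      (stdComplexStructure v 3) _ _ _ _ _ C rfl hc₀ hc₀' hc₁ hc₂ hL h16 hT3
      (stdComplexStructure_apply_zero v) (stdComplexStructure_apply_one v)
      (stdComplexStructure_apply_two v) (stdComplexStructure_apply_three v)
  · obtain ⟨h1, h16⟩ := shell_coords hx
    exact level_ineq (x 0) (x 1) (x 2) (x 3) _ (by positivity) h16 h1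

end Summit.SmoothPoincare4.SmoothPoincare4.Theorems.HyperbolicEnd.Negative

end
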